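import Summits.CriticalPhenomena.CardyFormulaZ2.Theses.DyadicBetaRigidity
import Summits.CriticalPhenomena.CardyFormulaZ2.Theorems.DyadicBetaRigidityDyadicBetaSufficesBeta
import Literature.Probability.RandomPlanarGeometry.ConformalRectangleProofs
import Literature.Probability.Percolation.QuadCrossingSquareModel
import Literature.Probability.Percolation.RSW

/-!
# `DyadicLatticeBetaLaw` (crux stmt-CriticalPhenomena-18183, route `DyadicBetaRigidity` of
# `CardyFormulaZ2`): the uniformizing hypothesis is load-bearing; the side condition `0 < h` is not
# (at `h = 0`); every lattice box is a lattice polygon (negative-side support, cdisprove seat)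

The crux reads `∃ a ∈ (0,1), ∀ h > 0, ∀ R` (conformal rectangle whose frontier is covered by finitely
many edges of `hℤ²`), `∀ (φ, x)`, `R.IsUniformizing φ x →`
`bondDomainCrossingProb R (h/2^k) ⟶ I_a(crossRatio x)` with
`I_a(η) = ∫₀^η (s(1-s))^{-a} / ∫₀¹ (s(1-s))^{-a}`.  It is a corollary of `CardyFormulaZ2` (`a = 2/3`,
crux work file `Cruxes/DyadicLatticeBetaLaw/Disproof.lean`), so no refutation of the crux itself is
on the table short of `¬ CardyFormulaZ2`.  This file records, sorry-free and without introducing any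
definition, which of its hypotheses carry weight:

* `isLatticePolygon_box` — **every lattice box is a lattice polygon**: a conformal rectangle with
  carrier `(0, hM) × (0, hN)` (`M, N ≥ 1`, marks anywhere) satisfies the crux's lattice hypothesis at
  mesh `h` (the `2M + 2N` boundary edges).  Positive by-product for the line's provers (boxes of all
  rational aspect ratios enter the hypothesis class at suitable meshes); here it supplies the witnesses.
* `dyadicLatticeBetaLaw_false_without_isUniformizing` — dropping `R.IsUniformizing φ x` makes the
  statement FALSE for every exponent: the unit square's dyadic sequence would have to tend both to
  `I_a(crossRatio (0,0,0,0)) = I_a(0) = 0` and to `I_a(crossRatio (0,1,1,3)) = I_a(1) = 1`.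
* `not_latticePolygon_mesh_zero` — at `h = 0` the lattice hypothesis is unsatisfiable (all edges of
  `0·ℤ²` collapse to the point `0`, while `∂R ∋ pt 0 ≠ pt 1`), so the side condition `0 < h` excludes
  nothing there (and `h < 0` is the `-ℤ² = ℤ²` reflection of `-h`): `0 < h` is NOT load-bearing.

Moral for provers: the only analytic content is in the limit itself; the hypotheses other than
`IsUniformizing` (which pins the VALUE) are bookkeeping.  This file does NOT refute the crux.
-/

noncomputable section

namespace Summit.CriticalPhenomena.CardyFormulaZ2.Theorems.DyadicLatticeBetaLaw.Negative

open Filter Topology Set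
open Literature.Probability.RandomPlanarGeometry Literature.Probability.Percolation
open Literature.Probability.LatticeModels

/-! ### Lattice boxes are lattice polygons -/

/-- Real part of the mesh point `h · (i, j)`. [folklore] -/
theorem meshPoint_pt_re (h : ℝ) (i j : ℤ) : (meshPoint h (pt i j)).re = h * i := by simp [pt]

/-- Imaginary part of the mesh point `h · (i, j)`. [folklore] -/
theorem meshPoint_pt_im (h : ℝ) (i j : ℤ) : (meshPoint h (pt i j)).im = h * j := by simp [pt]

/-- Mesh windows: a real `s ∈ [0, hM]` (`h > 0`, `M ≥ 1`) lies in some lattice window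
`[h i, h (i + 1)]` with `i < M`. [folklore] -/
theorem exists_mesh_window {h s : ℝ} (hh : 0 < h) {M : ℕ} (hM : 0 < M) (h0 : 0 ≤ s)
    (h1 : s ≤ h * M) : ∃ i : ℕ, i < M ∧ h * i ≤ s ∧ s ≤ h * (i + 1) := by
  have ht0 : 0 ≤ s / h := div_nonneg h0 hh.le
  rcases lt_or_eq_of_le h1 with hlt | heq
  · refine ⟨⌊s / h⌋₊, (Nat.floor_lt ht0).2 (by rwa [div_lt_iff₀ hh, mul_comm]), ?_, ?_⟩
    · have := Nat.floor_le ht0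
      rw [le_div_iff₀ hh, mul_comm] at this
      exact this
    · have := (Nat.lt_floor_add_one (s / h)).le
      rw [div_le_iff₀ hh, mul_comm] at this
      exact this
  · refine ⟨M - 1, Nat.sub_lt hM one_pos, ?_, ?_⟩
    · rw [heq, Nat.cast_sub (by omega : 1 ≤ M)]; push_cast; nlinarith
    · rw [heq, Nat.cast_sub (by omega : 1 ≤ M)]; push_cast; nlinarith

/-- **Every lattice box is a lattice polygon.** A conformal rectangle whose carrier is the open box
`(0, hM) × (0, hN)` (`h > 0`; `M, N ≥ 1` integers; marks anywhere) has its frontier covered by the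
`2M + 2N` edges of `hℤ²` on its sides — the lattice hypothesis of `DyadicLatticeBetaLaw` at mesh `h`,
stated verbatim. [folklore] -/
theorem isLatticePolygon_box {h : ℝ} (hh : 0 < h) {M N : ℕ} (hM : 0 < M) (hN : 0 < N)
    (R : ConformalRectangle) (hR : R.carrier = (Ioo (0 : ℝ) (h * M) ×ℂ Ioo (0 : ℝ) (h * N))) :
    ∃ S : Finset (ℂ × ℂ), (∀ p ∈ S, ∃ u v : Site 2, (zdGraph 2).Adj u v ∧ p.1 = meshPoint h u ∧
      p.2 = meshPoint h v) ∧ frontier R.carrier ⊆ ⋃ p ∈ S, segment ℝ p.1 p.2 := by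
  classical
  have hMr : (0 : ℝ) < h * M := mul_pos hh (by exact_mod_cast hM)
  have hNr : (0 : ℝ) < h * N := mul_pos hh (by exact_mod_cast hN)
  have hadj0 : ∀ i j : ℤ, (zdGraph 2).Adj (pt i j) (pt (i + 1) j) := fun i j => by
    rw [pt_succ_eq]; exact (SimpleGraph.mem_edgeSet _).1 (single_edge_mem _ _)
  have hadj1 : ∀ i j : ℤ, (zdGraph 2).Adj (pt i j) (pt i (j + 1)) := fun i j => by
    have e : pt i (j + 1) = pt i j + Pi.single 1 1 := by ext k; fin_cases k <;> simp [pt]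
    rw [e]; exact (SimpleGraph.mem_edgeSet _).1 (single_edge_mem _ _)
  set E : Finset (ℂ × ℂ) :=
    ((Finset.range M).image fun i : ℕ => (meshPoint h (pt i 0), meshPoint h (pt (i + 1) 0))) ∪
      ((Finset.range M).image fun i : ℕ => (meshPoint h (pt i N), meshPoint h (pt (i + 1) N))) ∪
      (((Finset.range N).image fun j : ℕ => (meshPoint h (pt 0 j), meshPoint h (pt 0 (j + 1)))) ∪
        ((Finset.range N).image fun j : ℕ => (meshPoint h (pt M j), meshPoint h (pt M (j + 1)))))
    with hE
  refine ⟨E, ?_, ?_⟩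
  · intro p hp
    rw [hE] at hp
    simp only [Finset.mem_union, Finset.mem_image, Finset.mem_range] at hp
    rcases hp with (⟨i, -, rfl⟩ | ⟨i, -, rfl⟩) | (⟨j, -, rfl⟩ | ⟨j, -, rfl⟩)
    · exact ⟨_, _, hadj0 _ _, rfl, rfl⟩
    · exact ⟨_, _, hadj0 _ _, rfl, rfl⟩
    · exact ⟨_, _, hadj1 _ _, rfl, rfl⟩
    · exact ⟨_, _, hadj1 _ _, rfl, rfl⟩
  · intro p hp
    rw [hR, Complex.frontier_reProdIm, closure_Ioo hMr.ne, frontier_Ioo hMr, closure_Ioo hNr.ne,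
      frontier_Ioo hNr, mem_union, Complex.mem_reProdIm, Complex.mem_reProdIm] at hp
    simp only [mem_Icc, mem_insert_iff, mem_singleton_iff] at hp
    rcases hp with ⟨⟨h0, h1⟩, him⟩ | ⟨hre, h0, h1⟩
    · -- bottom or top side: window in the real part
      obtain ⟨i, hiM, hi1', hi2'⟩ := exists_mesh_window hh hM h0 h1
      rcases him with him | him
      · have hmem : (meshPoint h (pt i 0), meshPoint h (pt (i + 1) 0)) ∈ E := by
          rw [hE]
          exact Finset.mem_union_left _ (Finset.mem_union_left _
            (Finset.mem_image.2 ⟨i, Finset.mem_range.2 hiM, rfl⟩))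
        refine mem_iUnion₂_of_mem hmem ?_
        rw [mem_segment_iff_of_im_eq (by simp only [meshPoint_pt_re]; push_cast; nlinarith)
          (by simp only [meshPoint_pt_im])]
        simp only [meshPoint_pt_re, meshPoint_pt_im, Int.cast_natCast, Int.cast_zero, Int.cast_add,
          Int.cast_one, mul_zero, mem_Icc]
        exact ⟨him, hi1', hi2'⟩
      · have hmem : (meshPoint h (pt i N), meshPoint h (pt (i + 1) N)) ∈ E := by
          rw [hE]
          exact Finset.mem_union_left _ (Finset.mem_union_right _
            (Finset.mem_image.2 ⟨i, Finset.mem_range.2 hiM, rfl⟩))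
        refine mem_iUnion₂_of_mem hmem ?_
        rw [mem_segment_iff_of_im_eq (by simp only [meshPoint_pt_re]; push_cast; nlinarith)
          (by simp only [meshPoint_pt_im])]
        simp only [meshPoint_pt_re, meshPoint_pt_im, Int.cast_natCast, Int.cast_add, Int.cast_one,
          mem_Icc]
        exact ⟨him, hi1', hi2'⟩
    · -- left or right side: window in the imaginary part
      obtain ⟨j, hjN, hj1', hj2'⟩ := exists_mesh_window hh hN h0 h1
      rcases hre with hre | hre
      · have hmem : (meshPoint h (pt 0 j), meshPoint h (pt 0 (j + 1))) ∈ E := by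
          rw [hE]
          exact Finset.mem_union_right _ (Finset.mem_union_left _
            (Finset.mem_image.2 ⟨j, Finset.mem_range.2 hjN, rfl⟩))
        refine mem_iUnion₂_of_mem hmem ?_
        rw [mem_segment_iff_of_re_eq (by simp only [meshPoint_pt_im]; push_cast; nlinarith)
          (by simp only [meshPoint_pt_re])]
        simp only [meshPoint_pt_re, meshPoint_pt_im, Int.cast_natCast, Int.cast_zero, Int.cast_add,
          Int.cast_one, mul_zero, mem_Icc]
        exact ⟨hre, hj1', hj2'⟩
      · have hmem : (meshPoint h (pt M j), meshPoint h (pt M (j + 1))) ∈ E := by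
          rw [hE]
          exact Finset.mem_union_right _ (Finset.mem_union_right _
            (Finset.mem_image.2 ⟨j, Finset.mem_range.2 hjN, rfl⟩))
        refine mem_iUnion₂_of_mem hmem ?_
        rw [mem_segment_iff_of_re_eq (by simp only [meshPoint_pt_im]; push_cast; nlinarith)
          (by simp only [meshPoint_pt_re])]
        simp only [meshPoint_pt_re, meshPoint_pt_im, Int.cast_natCast, Int.cast_add, Int.cast_one,
          mem_Icc]
        exact ⟨hre, hj1', hj2'⟩

/-- **The open unit square `(0,1)²` (tree: `rectQuad 0 1 0 1`, corners marked) is a lattice polygon of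
`ℤ²`** (mesh `1`). [folklore] -/
theorem unitSquare_isLatticePolygon :
    ∃ S : Finset (ℂ × ℂ), (∀ p ∈ S, ∃ u v : Site 2, (zdGraph 2).Adj u v ∧ p.1 = meshPoint 1 u ∧
      p.2 = meshPoint 1 v) ∧
      frontier (rectQuad 0 1 0 1 zero_lt_one zero_lt_one).carrier ⊆ ⋃ p ∈ S, segment ℝ p.1 p.2 :=
  isLatticePolygon_box (M := 1) (N := 1) one_pos one_pos one_pos _ (by rw [rectQuad_carrier]; norm_num)

/-! ### The uniformizing hypothesis is load-bearing -/

/-- A degenerate (constant) quadruple has cross-ratio `0` (junk value of the division). [folklore] -/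
theorem crossRatio_const (c : ℝ) : crossRatio (fun _ : Fin 4 => c) = 0 := by
  simp [crossRatio]

/-- The non-monotone quadruple `(0, 1, 1, 3)` has cross-ratio `1`. [folklore] -/
theorem crossRatio_zero_one_one_three : crossRatio ![(0 : ℝ), 1, 1, 3] = 1 := by
  norm_num [crossRatio, Matrix.cons_val_two, Matrix.cons_val_three]

/-- **`R.IsUniformizing φ x` is load-bearing in `DyadicLatticeBetaLaw`.** The crux with that single
hypothesis dropped (stated inline) is false for EVERY exponent `a ∈ (0,1)`: applied to the unit square
at mesh `1` with the constant quadruple (`crossRatio = 0`, limit `I_a(0) = 0`) and with the quadruple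
`(0,1,1,3)` (`crossRatio = 1`, limit `I_a(1) = 1` since `∫₀¹ (s(1-s))^{-a} > 0`, tree lemma
`DyadicLattice.beta_pos`), it would force one sequence to have two limits. [folklore] -/
theorem dyadicLatticeBetaLaw_false_without_isUniformizing :
    ¬ (∃ a : ℝ, a ∈ Set.Ioo (0 : ℝ) 1 ∧ ∀ h : ℝ, 0 < h → ∀ R : ConformalRectangle,
        (∃ S : Finset (ℂ × ℂ), (∀ p ∈ S, ∃ u v : Site 2, (zdGraph 2).Adj u v ∧
            p.1 = meshPoint h u ∧ p.2 = meshPoint h v) ∧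
            frontier R.carrier ⊆ ⋃ p ∈ S, segment ℝ p.1 p.2) →
        ∀ (φ : ConformalEquiv UpperHalfPlane.upperHalfPlaneSet R.carrier) (x : Fin 4 → ℝ),
          Tendsto (fun k : ℕ => bondDomainCrossingProb R (h / 2 ^ k)) atTop
            (𝓝 ((∫ s in (0 : ℝ)..crossRatio x, (s * (1 - s)) ^ (-a)) /
              ∫ s in (0 : ℝ)..1, (s * (1 - s)) ^ (-a)))) := by
  rintro ⟨a, ha, H⟩
  obtain ⟨φ, -, -⟩ :=
    MarkedDomain.exists_isUniformizing_holds (rectQuad 0 1 0 1 zero_lt_one zero_lt_one)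
  have h0 := H 1 one_pos _ unitSquare_isLatticePolygon φ (fun _ => 0)
  have h1 := H 1 one_pos _ unitSquare_isLatticePolygon φ ![(0 : ℝ), 1, 1, 3]
  rw [crossRatio_const, intervalIntegral.integral_same, zero_div] at h0
  rw [crossRatio_zero_one_one_three, div_self (DyadicLattice.beta_pos ha.2).ne'] at h1
  have h01 := tendsto_nhds_unique h0 h1
  norm_num at h01

/-! ### The side condition `0 < h` is not load-bearing at `h = 0` -/

/-- **At mesh `0` the lattice hypothesis is unsatisfiable**: every edge of `0·ℤ²` collapses to the
point `0`, while the frontier of a Jordan domain contains the two distinct marked points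
`pt 0 ≠ pt 1`; so `∀ h > 0` and `∀ h ≥ 0` versions of the crux coincide. [folklore] -/
theorem not_latticePolygon_mesh_zero (R : ConformalRectangle) :
    ¬ ∃ S : Finset (ℂ × ℂ), (∀ p ∈ S, ∃ u v : Site 2, (zdGraph 2).Adj u v ∧ p.1 = meshPoint 0 u ∧
      p.2 = meshPoint 0 v) ∧ frontier R.carrier ⊆ ⋃ p ∈ S, segment ℝ p.1 p.2 := by
  rintro ⟨S, hS, hfr⟩
  have hsub : frontier R.carrier ⊆ {(0 : ℂ)} := by
    intro p hp
    have hp' := hfr hp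
    simp only [mem_iUnion, exists_prop] at hp'
    obtain ⟨q, hq, hpq⟩ := hp'
    obtain ⟨u, v, -, h1, h2⟩ := hS q hq
    have hq1 : q.1 = 0 := by rw [h1]; simp [meshPoint]
    have hq2 : q.2 = 0 := by rw [h2]; simp [meshPoint]
    rw [hq1, hq2, segment_same ℝ] at hpq
    exact hpq
  have h0 : R.pt 0 = 0 := hsub (MarkedDomain.pt_mem_frontier R 0)
  have h1 : R.pt 1 = 0 := hsub (MarkedDomain.pt_mem_frontier R 1)
  have h01 : (0 : Fin 4) = 1 := MarkedDomain.pt_injective R (h0.trans h1.symm)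
  exact absurd h01 (by decide)

end Summit.CriticalPhenomena.CardyFormulaZ2.Theorems.DyadicLatticeBetaLaw.Negative

end
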